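import Summits.Ventures.HodgeRepro2.T5FinitePlaceDecompAut

/-!
# Galois transport between completions: `σ • w = w'` gives `L_w ≃ₐ[Kᵥ] L_{w'}` (cell pub-hodge-repro2, seat p3)

Tier-5 N2 support, §N2.9.2 of route/T5-N2-route-3.md («completions») at the finite places — the generalisation of
file 121 (the decomposition group acting on ONE completion) to an automorphism `σ : L ≃ₐ[K] L` moving `w` to `w'`:
`w'(σ x) = w(x)` (`valuation_smul`), `σ` is uniformly continuous from the `w`-adic to the `w'`-adic uniformity
(`uniformContinuous_withValMap`), and extends to a continuous ring map `transport σ : L_w →+* L_{w'}`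
(`transport_coe`) which is `Kᵥ`-linear (`transport_algebraMap_left`) and bijective (its inverse is the transport of
`σ⁻¹`), hence a `Kᵥ`-algebra isomorphism `transportEquiv : L_w ≃ₐ[Kᵥ] L_{w'}`. On the CM field at a SPLIT place
this is «the complex conjugation swaps the two completions `K_w ≃ K_{c • w}`» (the involution that makes the local
unitary group at a split place a general linear group). Mathlib + files 115, 121 only. No display; no device.
§8(d): uses an L-value-free non-vanishing device: NO.
-/

namespace Summit.Ventures.HodgeRepro2.T5FinitePlaceGaloisTransport

open IsDedekindDomain IsDedekindDomain.HeightOneSpectrum NumberField Module UniformSpace WithZero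
open scoped Summit.Ventures.HodgeRepro2.T5FinitePlaceLiesOver Pointwise
open Summit.Ventures.HodgeRepro2.T5FinitePlaceLiesOver Summit.Ventures.HodgeRepro2.T5FinitePlaceDecompAut

section General

variable {K L : Type*} [Field K] [Field L] [NumberField L] [Algebra K L]
variable (w w' : HeightOneSpectrum (𝓞 L)) (σ : L ≃ₐ[K] L) (hw : σ • w.asIdeal = w'.asIdeal)

omit [NumberField L] in
include hw in
/-- `σ • r ∈ w'ⁿ ↔ r ∈ wⁿ` when `σ • w = w'`. -/
theorem smul_mem_pow_iff (r : 𝓞 L) (n : ℕ) : σ • r ∈ w'.asIdeal ^ n ↔ r ∈ w.asIdeal ^ n := by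
  conv_lhs => rw [← hw, Ideal.pointwise_smul_def, ← Ideal.map_pow, ← Ideal.pointwise_smul_def]
  exact Ideal.smul_mem_pointwise_smul_iff

include hw in
/-- **`w'(σ r) = w(r)`** on the ring of integers when `σ • w = w'`. -/
theorem intValuation_smul (r : 𝓞 L) : w'.intValuation (σ • r) = w.intValuation r :=
  eq_of_forall_le_exp_neg_iff (w'.intValuation_le_one _) (w.intValuation_le_one _) fun n => by
    rw [intValuation_le_pow_iff_mem, intValuation_le_pow_iff_mem, smul_mem_pow_iff w w' σ hw]

include hw in
/-- **`w'(σ x) = w(x)`** on `L` when `σ • w = w'`. -/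
theorem valuation_smul (x : L) : w'.valuation L (σ x) = w.valuation L x := by
  obtain ⟨a, b, hb, rfl⟩ := IsFractionRing.div_surjective (A := 𝓞 L) x
  have ha : σ (algebraMap (𝓞 L) L a) = algebraMap (𝓞 L) L (σ • a) := rfl
  have hb' : σ (algebraMap (𝓞 L) L b) = algebraMap (𝓞 L) L (σ • b) := rfl
  rw [map_div₀, ha, hb', map_div₀, map_div₀, valuation_of_algebraMap, valuation_of_algebraMap,
    valuation_of_algebraMap, valuation_of_algebraMap, intValuation_smul w w' σ hw, intValuation_smul w w' σ hw]

/-- `σ` as a ring map `WithVal (w.valuation L) →+* WithVal (w'.valuation L)`. -/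
noncomputable def withValMap : WithVal (w.valuation L) →+* WithVal (w'.valuation L) :=
  WithVal.map _ _ σ.toRingHom

include hw in
/-- `σ` carries the `w`-adic valuation to the `w'`-adic one. -/
theorem valued_withValMap (x : WithVal (w.valuation L)) : Valued.v (withValMap w w' σ x) = Valued.v x := by
  show w'.valuation L (σ x.ofVal) = w.valuation L x.ofVal
  exact valuation_smul w w' σ hw x.ofVal

include hw in
/-- **`σ` is uniformly continuous from the `w`-adic to the `w'`-adic uniformity** when `σ • w = w'`. -/
theorem uniformContinuous_withValMap : UniformContinuous (withValMap w w' σ) := by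
  refine uniformContinuous_of_continuousAt_zero (withValMap w w' σ) ?_
  rw [ContinuousAt, map_zero, Filter.tendsto_def]
  intro s hs
  obtain ⟨γ, hγ⟩ := Valued.mem_nhds_zero.mp hs
  -- the radius of the target ball, as an element `g ≠ 0` of `ℤᵐ⁰`, realised by an element `x₀` of the source
  have h0 : Valued.v (0 : WithVal (w'.valuation L)) < _ :=
    (Valuation.restrict_lt_iff_lt_embedding (v := (Valued.v : Valuation (WithVal (w'.valuation L)) ℤᵐ⁰))).mp
      (by rw [map_zero]; exact Units.zero_lt γ)
  rw [map_zero] at h0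
  obtain ⟨x₀, hx₀⟩ := (w.valuation_surjective L) _
  have hx₀' : Valued.v (WithVal.toVal (w.valuation L) x₀) ≠ 0 := by
    show w.valuation L x₀ ≠ 0
    rw [hx₀]
    exact h0.ne'
  refine Valued.mem_nhds_zero.mpr ⟨Units.mk0 (Valued.v.restrict (WithVal.toVal (w.valuation L) x₀))
    (by rwa [Ne, Valuation.restrict_eq_zero_iff]), fun x hx => hγ ?_⟩
  simp only [Set.mem_setOf_eq, Units.val_mk0, Valuation.restrict_lt_iff] at hx
  simp only [Set.mem_setOf_eq, Valuation.restrict_lt_iff_lt_embedding]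
  rw [valued_withValMap w w' σ hw]
  calc Valued.v x < Valued.v (WithVal.toVal (w.valuation L) x₀) := hx
    _ = _ := hx₀

/-- **The transport `L_w →+* L_{w'}` of `σ`** (for `σ • w = w'`). -/
noncomputable def transport : w.adicCompletion L →+* w'.adicCompletion L :=
  ((adicCompletion.equiv L w').symm.toRingHom.comp
    (Completion.mapRingHom (withValMap w w' σ) (uniformContinuous_withValMap w w' σ hw).continuous)).comp
    (adicCompletion.equiv L w).toRingHom

/-- `transport σ` restricted to `L` is `σ`. -/
theorem transport_coe (x : L) : transport w w' σ hw (x : w.adicCompletion L) = (σ x : w'.adicCompletion L) := by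
  apply adicCompletion.ext
  exact Completion.mapRingHom_coe _ _

/-- `transport σ` is continuous. -/
theorem continuous_transport : Continuous (transport w w' σ hw) :=
  (adicCompletion.continuous_ofCompletion L w').comp <|
    Completion.continuous_map.comp (adicCompletion.continuous_toCompletion L w)

omit [NumberField L] in
include hw in
/-- `σ⁻¹ • w' = w`. -/
theorem inv_smul_eq : σ⁻¹ • w'.asIdeal = w.asIdeal := by
  rw [← hw, inv_smul_smul]

/-- The transports of `σ` and `σ⁻¹` are inverse to each other (`L_w → L_{w'} → L_w`). -/
theorem transport_transport_inv (z : w.adicCompletion L) :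
    transport w' w σ⁻¹ (inv_smul_eq w w' σ hw) (transport w w' σ hw z) = z := by
  have hd : DenseRange (algebraMap L (w.adicCompletion L)) := denseRange_algebraMap (K := L) (v := w)
  have h1 : Continuous fun y : w.adicCompletion L =>
      transport w' w σ⁻¹ (inv_smul_eq w w' σ hw) (transport w w' σ hw y) :=
    (continuous_transport w' w σ⁻¹ _).comp (continuous_transport w w' σ hw)
  refine congrFun (hd.equalizer h1 continuous_id (funext fun x => ?_)) z
  simp only [Function.comp_apply, id_eq]
  have hx : σ⁻¹ (σ x) = x := by rw [← AlgEquiv.mul_apply, inv_mul_cancel, AlgEquiv.one_apply]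
  rw [show algebraMap L (w.adicCompletion L) x = (x : w.adicCompletion L) from rfl, transport_coe, transport_coe, hx]

/-- The transports of `σ⁻¹` and `σ` are inverse to each other (`L_{w'} → L_w → L_{w'}`). -/
theorem transport_inv_transport (z : w'.adicCompletion L) :
    transport w w' σ hw (transport w' w σ⁻¹ (inv_smul_eq w w' σ hw) z) = z := by
  have hd : DenseRange (algebraMap L (w'.adicCompletion L)) := denseRange_algebraMap (K := L) (v := w')
  have h1 : Continuous fun y : w'.adicCompletion L =>
      transport w w' σ hw (transport w' w σ⁻¹ (inv_smul_eq w w' σ hw) y) :=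
    (continuous_transport w w' σ hw).comp (continuous_transport w' w σ⁻¹ _)
  refine congrFun (hd.equalizer h1 continuous_id (funext fun x => ?_)) z
  simp only [Function.comp_apply, id_eq]
  have hx : σ (σ⁻¹ x) = x := by rw [← AlgEquiv.mul_apply, mul_inv_cancel, AlgEquiv.one_apply]
  rw [show algebraMap L (w'.adicCompletion L) x = (x : w'.adicCompletion L) from rfl, transport_coe, transport_coe, hx]

/-- `transport σ` is bijective. -/
theorem transport_bijective : Function.Bijective (transport w w' σ hw) :=
  ⟨(transport w w' σ hw).injective, fun z => ⟨_, transport_inv_transport w w' σ hw z⟩⟩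

variable [NumberField K] (v : HeightOneSpectrum (𝓞 K)) [w.asIdeal.LiesOver v.asIdeal] [w'.asIdeal.LiesOver v.asIdeal]

/-- **`transport σ` is `Kᵥ`-linear:** it carries `algebraMap Kᵥ L_w` to `algebraMap Kᵥ L_{w'}` (density of `K`). -/
theorem transport_algebraMap_left (a : v.adicCompletion K) :
    transport w w' σ hw (algebraMap (v.adicCompletion K) (w.adicCompletion L) a) =
      algebraMap (v.adicCompletion K) (w'.adicCompletion L) a := by
  have hd : DenseRange (algebraMap K (v.adicCompletion K)) := denseRange_algebraMap (K := K) (v := v)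
  have h1 : Continuous fun y : v.adicCompletion K =>
      transport w w' σ hw (algebraMap (v.adicCompletion K) (w.adicCompletion L) y) :=
    (continuous_transport w w' σ hw).comp (continuous_completionMap K L v w)
  have h2 : Continuous fun y : v.adicCompletion K => algebraMap (v.adicCompletion K) (w'.adicCompletion L) y :=
    continuous_completionMap K L v w'
  refine congrFun (hd.equalizer h1 h2 (funext fun k => ?_)) a
  simp only [Function.comp_apply]
  rw [show algebraMap K (v.adicCompletion K) k = (k : v.adicCompletion K) from rfl, algebraMap_eq_completionMap,
    completionMap_coe, transport_coe, AlgEquiv.commutes, algebraMap_eq_completionMap, completionMap_coe]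

/-- **`L_w ≃ₐ[Kᵥ] L_{w'}`:** the transport of `σ` as a `Kᵥ`-algebra isomorphism. -/
noncomputable def transportEquiv : w.adicCompletion L ≃ₐ[v.adicCompletion K] w'.adicCompletion L :=
  AlgEquiv.ofBijective
    { transport w w' σ hw with commutes' := transport_algebraMap_left w w' σ hw v }
    (transport_bijective w w' σ hw)

/-- `transportEquiv` is `transport`. -/
theorem transportEquiv_apply (z : w.adicCompletion L) : transportEquiv w w' σ hw v z = transport w w' σ hw z := rfl

/-- `transportEquiv` on `L` is `σ`. -/
theorem transportEquiv_coe (x : L) :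
    transportEquiv w w' σ hw v (x : w.adicCompletion L) = (σ x : w'.adicCompletion L) :=
  transport_coe w w' σ hw x

end General

end Summit.Ventures.HodgeRepro2.T5FinitePlaceGaloisTransport
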